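import Mathlib
import HarnessLib
import HarnessLib.Audit
import Summits.KontsevichZagierPeriods.Statement
import Literature.NumberTheory.Transcendental.KZCalculus
import Literature.NumberTheory.Transcendental.KZKernelConjectureForms
import HarnessLib.Audit.Status.Attr

/-!
Route: RootDecompRelativeOneConservativity

# Route RootDecompRelativeOneConservativity — root decomposition (lens-3 RelativeOneConservativity)
— KZ equals relative-dimension-one transfer plus Conjecture 1 modulo that oracle

It suffices to show X = RelTransferOne ∧ KZModRelativeOne, and X is EQUIVALENT to the summit
(`node_iff`,
kernel-checked in the draft file HOME/decomp-kz-lens-3/RelativeOneConservativity.lean, 0 sorry): the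
root node of
the decomposition cell decomp-kz, lens «one certified translation + split beneath». The translation
is into the
proof theory of the calculus: for the sound oracle O₁ = {[r] − [r′] : r, r′ of dimension b+1 with
a.e.-equal
LAST-coordinate fibre integrals} (soundness = Fubini, `value_eq_integral_fibre`), completeness of KZ
⟺
(O₁ is conservative over KZ) ∧ (KZ + O₁ is complete). RelTransferOne = conservativity = Conjecture 1
in relative
dimension one (verbatim the shared item stmt-KontsevichZagierPeriods-5082 of MellinCoarea /
EqualShadows);
KZModRelativeOne = Conjecture 1 modulo O₁, the DECLARED RESIDUAL, certified to lie below the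
recorded residual
AbelContraction.ReductionToDimensionOne (stmt-14403) by
`kzModRelativeOne_of_reductionToDimensionOne`.
ROOT DECOMPOSITION CELL decomp-kz (D-0178), generation 0, node C = lens-3
«RelativeOneConservativity» v1 (NODE 2026-08-30T01:22:45Z; kernel file
HOME/decomp-kz-lens-3/RelativeOneConservativity.lean sha256
c017547e6c086467e28b5e0eb1e90ebd85a1eafad2b257677d49e3cc20e9ed22: `closes`, `node_iff`, both
`_of_summit` necessity theorems, rc 0, 0 sorry, std axioms), CLEARED by the critic decomp-kz-crit-1
2026-08-30T01:28:16Z as a ROOT AND-node with a declared residual (kernel identity of record: S ↔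
Conservative(O₁) ∧ Complete(KZ + O₁), `critic_node_iff_calculus`; HOME/CRITIC-LEDGER.md row 3,
HOME/critic/L3_RelativeOneConservativity_v1_probe.lean); filed by the cell writer decomp-kz-writer-1
as an OR-sibling of route-KontsevichZagierPeriods-RootDecompDescentLadder (native `closes`
certification rc 0, BC2 C → S probes FAIL 2/2, BC7 2/2 CLEAN, tribunal pre-check --full
tk=PROVISIONAL with residual := KZModRelativeOne). Tags: P1 RelTransferOne WEAKER·ATTACKABLE(b = 0
layer)+INSTRUMENTABLE, IDEA-NEEDED above (= item stmt-KontsevichZagierPeriods-5082, shared) · P2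
KZModRelativeOne DECLARED-RESIDUAL(RelTransferOne)·IDEA-NEEDED (≤ ReductionToDimensionOne 14403).
The single EQUIV (`node_iff`) is the AND-exactness certificate, recorded in the lens file, not an
item. Cross-edge (critic w3): this node and RootDecompDescentLadder share the KZ_le 1 sub-layer
(item 4990 ⟹ it). census of record HOME/census/COSTUME-CENSUS-v1.md sha256
d820a1ccef7038cf1cf2195521173f232f3fb9dc74eaa204c7dee97b259d5198 (json
b41930f92fedc36ffa76fd1e9f0034d3b117c647635515f1ba8fb90c700a24cf) (rows EQ9 / L1 / W-rows map the
pieces). WHY THIS IS NOVEL: the first root split of this summit by FIBRE dimension rather than total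
dimension — conservativity of the sound relative-dimension-one oracle O₁ over the moves plus
completeness of KZ + O₁ — with the translation into calculus terms kernel-certified and the residual
certified below the recorded all-dimension residual 14403. Rung currency: rung 0 — nothing here
proves the summit.
Lean:
`Summit.KontsevichZagierPeriods.KontsevichZagierPeriods.Theses.RootDecompRelativeOneConservativity.RelTransferOne
∧
Summit.KontsevichZagierPeriods.KontsevichZagierPeriods.Theses.RootDecompRelativeOneConservativity.KZModRelativeOne`

## Assembly
Pure logic plus Fubini: conservativity (RelTransferOne) says `KZ.relations` is itself an O₁-closed
subgroup
containing the moves, so completeness modulo O₁ (KZModRelativeOne) applied to R := KZ.relations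
yields
[r] − [r′] ∈ relations for every KZ-rational equal-valued pair, i.e. the summit (`closes`, both
binders consumed).
Conversely S gives both pieces (`relTransferOne_of_summit` via `value_eq_integral_fibre` +
`kzPeriodConjecture'_iff_isRational`;
`kzModRelativeOne_of_summit` via relations ≤ R), whence `node_iff : KontsevichZagierPeriods ↔
RelTransferOne ∧ KZModRelativeOne`.

Rationale: WHY THIS LINE. Every honest two-piece root split of Conjecture 1 found so far is «structural piece ∧
residual», and the residuals
on record (ReductionToDimensionOne 14403, ReductionToDimensionTwo 18030, XMapKernelOfCells 18976)
adjoin only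
CONSTANT pairs of small dimension, so they are ≡ S modulo the Huber–Wüstholz layer (census
2026-08-29). This line
adjoins instead the whole RELATIVE-DIMENSION-ONE oracle — 1-periods (b = 0, HuberWustholz2022 Thm
13.3) AND
1-periods in families over any base (b ≥ 1) — which is exactly the layer where the period conjecture
is a
THEOREM in its functional form (Ayoub2015 Thm 1.8 «version relative de la conjecture des périodes»,
Rem 1.9;
BakkerTsimerman2025, the geometric André–Grothendieck period conjecture; Ax–Schanuel for mixed
period maps
arXiv:2101.10938, arXiv:2101.10968), imported from functional transcendence / o-minimality; the
conservativity
piece asks to turn those theorems into uniform move templates on ℚ-semialgebraic cells of the base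
(Ayoub2015
Rem 1.10: a rules-formulation «dépendrait d'une variante relative du Fait 1.4» — the typed gap).
What it does
that prior routes do not: MellinCoarea filters S by fibre dimension with top piece FibrewiseTransfer
≡ S and no
residual; EqualShadows pairs 5082 with RelEquiSlice, which S does not imply; here both pieces are
implied by S,
the conjunction is S exactly, and the residual is certified strictly below 14403; negatives index:
only
stmt-5394 (KinematicPlaneConvex, unrelated).

RANKED CRUXES. #2 RelTransferOne (crux) — [ROOT-DECOMP decomp-kz gen 0 · node C piece P1 · tag
WEAKER — S ⟹ P1 by `relTransferOne_of_summit` (Fubini along Fin.snoc, `value_eq_of_fibre_ae`;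
HOME/decomp-kz-lens-3/RelativeOneConservativity.lean sha256
c017547e6c086467e28b5e0eb1e90ebd85a1eafad2b257677d49e3cc20e9ed22); P1 ⟹ S NOT known (only via 5081 ≡
S or EqualShadows 10282 ∧ SweepDescent), BC2 probe P1 → S FAILS; critic translation
`critic_relTransferOne_iff_conservative` : P1 ↔ closure(relations ∪ O₁) = relations · NECESSARY
(binder hA of `closes`) · = item stmt-KontsevichZagierPeriods-5082 VERBATIM (shared with
MellinCoarea r2 / EqualShadows r5; critic w1) · leaf ATTACKABLE certified ONLY for the b = 0 layer
(dim-1 pairs ⟺ KZ_le 1 ⟸ PlanarAreas 4990 ⟸ HuberWustholzCurvePeriods, closed mod print — the same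
sub-layer as RootDecompDescentLadder P1, one seat two parents) + INSTRUMENTABLE (b = 1 test items
5083/3013/3014/5085 on landed engines 5084/3727/3598/3012/3015; census rows L1, H1); general b ≥ 1
layer IDEA-NEEDED/UNDECIDED-strength (test: does one b = 1 case close WITHOUT ramified base change)
· census of record HOME/census/COSTUME-CENSUS-v1.md sha256
d820a1ccef7038cf1cf2195521173f232f3fb9dc74eaa204c7dee97b259d5198 (json
b41930f92fedc36ffa76fd1e9f0034d3b117c647635515f1ba8fb90c700a24cf) · verdict: critic decomp-kz-crit-1
CLEARED 2026-08-30T01:28:16Z (HOME/STATUS.md line «CLEARED … lens-3 RelativeOneConservativity v1»,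
HOME/CRITIC-LEDGER.md row 3; probe HOME/critic/L3_RelativeOneConservativity_v1_probe.lean @79380f10
rc 0, std axioms)] relative-dimension-one transfer (conservativity of the oracle O₁): two
ℚ-semialgebraic representations of the same dimension b+1 whose fibre integrals over the last
coordinate agree for a.e. base point x ∈ ℝᵇ are KZ-equivalent; b = 0 is Conjecture 1 for all
1-dimensional representations, b ≥ 1 its version in families. Verbatim item
stmt-KontsevichZagierPeriods-5082. [difficulty: XL] (why it might fail: for b ≥ 1 the correspondence
explaining ρ ≡ ρ′ may exist only after a ramified base change (u ↦ u^{1/3}) or need base-dependent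
second-kind corrections with non-semialgebraic primitives, so no move template uniform on a cell
exists.) [HuberWustholz2022, Ayoub2015, BakkerTsimerman2025, AyoubRelKZRevisited,
KontsevichZagier2001, arXiv:2101.10938]
#3 KZModRelativeOne (crux) — [ROOT-DECOMP decomp-kz gen 0 · node C piece P2 · tag
DECLARED-RESIDUAL(RelTransferOne) — S ⟹ P2 by `kzModRelativeOne_of_summit`; P2 ⟹ (RelTransferOne →
S) (`critic_p2_conditional`), ≡ S the day item 5082 lands; a LABEL, never WEAKER-by-evidence;
tribunal role = residual (tribunal_fit); critic translation `critic_modRel_iff_enlarged` : P2 ↔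
Conjecture 1 (rational endpoints, untruncated) for the enlarged calculus closure(relations ∪ O₁) ·
NECESSARY (binder hB) · SHRINK certified as ≤ the recorded residual: ReductionToDimensionOne
(stmt-14403, AbelContraction) ⟹ P2 (`kzModRelativeOne_of_reductionToDimensionOne`, critic
`critic_residual_le_R1`); strictness UNDECIDED (test: does closure(relations ∪ {equal-valued dim-1
pairs}) already contain one genuinely parametric O₁ instance, e.g. DuplicationFamily 3727) · leaf
IDEA-NEEDED; the edge «RelEquiSlice ∧ SweepDescent ⟹ KZModRelativeOne» is CLAIMED by the lens, NOT
kernel-checked (conjectural edge, critic w4) · cell score gen 1 = shrink it · census of record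
HOME/census/COSTUME-CENSUS-v1.md sha256
d820a1ccef7038cf1cf2195521173f232f3fb9dc74eaa204c7dee97b259d5198 (json
b41930f92fedc36ffa76fd1e9f0034d3b117c647635515f1ba8fb90c700a24cf) · verdict: critic decomp-kz-crit-1
CLEARED 2026-08-30T01:28:16Z (HOME/STATUS.md line «CLEARED … lens-3 RelativeOneConservativity v1»,
HOME/CRITIC-LEDGER.md row 3; probe HOME/critic/L3_RelativeOneConservativity_v1_probe.lean @79380f10
rc 0, std axioms)] Conjecture 1 modulo the relative-dimension-one oracle (completeness of KZ + O₁),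
the DECLARED RESIDUAL: every subgroup R of formal combinations containing the four move sets and
closed under O₁ (R ∋ [r] − [r′] whenever r, r′ : IntegralRep (b+1) have a.e.-equal last-coordinate
fibre integrals) contains [r] − [r′] for every pair of KZ-rational representations with equal
values. Implied by S; implies RelTransferOne → S; implied by AbelContraction.ReductionToDimensionOne
(certified shrink). [difficulty: open-problem] (why it might fail: as a target it still contains
every weight ≥ 2 identity (ζ(2) = π²/6, Legendre's relation, Γ-products) modulo 1-motivic oracle
steps — Grothendieck-strength content; only live mechanism: EqualShadows' RelEquiSlice ∧
SweepDescent.) [KontsevichZagier2001, Ayoub2015, CressonViusos2022, HuberMullerStach2017]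

TWO-LAYER PLAN. Foreseen glued splits (not filed now): RelTransferOne ⇐ RelTransferOneBaseZero (b =
0: = PlanarAreas 4990 ∘ AreasToArcs 0117, closed modulo the named fact HuberWustholzCurvePeriods) →
RelTransferOnePos (b ≥ 1: ParametricTransport 3014-type uniform templates on base cells + boundary
recursion) → RelTransferOne — NOTE the draft shows b ≥ 1 ⟹ b = 0 by a cylinder + coordinate swap, so
the honest split is by MECHANISM (isoperiodic families with constant vs non-constant period map:
Ax–Schanuel branch / rigidity branch), k ≤ 3. KZModRelativeOne ⇐ RelEquiSlice (10282) → SweepDescent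
(10281) → KZModRelativeOne (EqualShadows' induction with P(0) := the oracle).

KILL CRITERIA. A refutation of RelTransferOne (an explicit pair of (b+1)-dimensional representations
with a.e.-equal last-coordinate fibre integrals and [r] − [r′] ∉ relations) refutes the SUMMIT (S ⟹
RelTransferOne is proved) — the route then closes refuted:RelTransferOne together with the problem;
likewise for KZModRelativeOne. A proof of RelTransferOne collapses the node (KZModRelativeOne
becomes ≡ S): re-cut with a larger oracle (relative dimension two) or hand over to EqualShadows. A
proof elsewhere of FibrewiseTransfer (5081) or of S moots the route.

NOT DECOMPOSED YET. The b = 0 / b ≥ 1 sub-layers of RelTransferOne (the draft proves b ≥ 1 ⟹ b = 0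
by cylinders, so a split by base dimension is redundant; the mechanism split waits for the first b =
1 certificate: TriplicationFibreTransfer 5083 / LegendreModulusPropagation 3013); the choice of
sweep in KZModRelativeOne (EqualShadows owns it); uniformity-in-cells lemmas (o-minimal definable
choice) are layer-2 children.

CHEAPEST FALSIFIER. Lookup + kernel: (i) is RelTransferOne → S already a tree theorem or cheap?
BC2/BC7 probe `#h21_crux_probe … summit := KontsevichZagierPeriods` on both pieces: VERDICT CLEAN
×2, C→S not closed (bc/bc7_probe.lean, rc 0); MellinCoarea's closes needs FibrewiseTransfer for ALL
k, EqualShadows needs RelEquiSlice — no P ⟹ S in tree. (ii) is the residual already ≡ S modulo a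
PROVED rung (lens-1's costume mechanism kernelDescentTo_iff_summit_of_rung)? It is ≡ S modulo
RelTransferOne only, whose b = 0 layer is closed only modulo the named fact
HuberWustholzCurvePeriods and whose b ≥ 1 layer is open (5082, 5083, 3013, 3014 open) — not costume
today; it BECOMES costume the day 5082 is proved (kill criterion above). (iii) value-0 / padding
tricks (which make every fibre-dimension-k ≥ 2 oracle absorb S): with 1-dimensional fibres a change
of variables cannot lower dimension, so an N ≥ 2-dimensional zero-valued combination is not
O₁-trivial for free — checked by hand, see NODE.md §costume census.

NUMBERS. b = 0 layer: KZ_leRat 1 PROVED (Baker), KZ_le 1 PROVED modulo HuberWustholzCurvePeriods; b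
= 1: CoareaShear 5084, DuplicationFamily 3727, MellinUniqueness 3598, KZStokes 3012, KZStokesBox
3015 PROVED; TriplicationFibreTransfer 5083, GammaBetaCoupling 5085, ParametricTransport 3014,
LegendreModulusPropagation 3013 OPEN; residual side: ReductionToDimensionOne 14403 OPEN (⟹
KZModRelativeOne proved here), RelEquiSlice 10282 / SweepDescent 10281 OPEN, EqualShadows assembly
10286 PROVED. Full table: HOME/decomp-kz-lens-3/relative_one_ledger.tsv.

DEFINITION REQUESTS. None: the fibre integral is spelled out over Fin.snoc (no new notion);
O₁-closedness is a hypothesis inside KZModRelativeOne, not a new AddSubgroup def.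

Novelty: Searches (2026-08-30): tree `rg "relations ≤ R" Theses/` (AbelContraction R₁/R₂ only: constant
pairs), `rg -i "fubini|fibre integ|Fin.snoc" Theses/ Theorems/` (MellinCoarea
FibrewiseTransfer/RelTransferOne, EqualShadows, KZCalculus NL proof); corpus hybrid «relative
version Kontsevich-Zagier period conjecture families function field» (hits Ayoub2015 =
paper:url-54a2e7be174a, HuberWustholz2022 book, BakkerTsimerman2025 = paper:arxiv-2208.05182, Pila
2022 pp 94–95: none formulates a conservativity split); corpus vsearch «fibrewise integrals of two
algebraic families agree almost everywhere implies equivalence by change of variables and Stokes»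
(no relevant hit); galaxy --star all «conjecture des périodes|version relative|relative period
conjecture» (no relevant hit), --star pdf «Kontsevich-Zagier» (10 rows: HW preprint
pdf:787249845856413760, Glanois thesis pdf:919486960 — none on oracle-relative completeness); lit
frontier/bridges KontsevichZagierPeriods (session 1: Ayoub, HW, Bakker–Tsimerman,
Sertöz–Ouaknine–Worrell arXiv:2505.20397).
Nearest prior art found: Ayoub2015 Thm 1.8 + Rem 1.9–1.10 [corpus:paper:url-54a2e7be174a p6] (the
relative KZ THEOREM for Laurent series of periods and the remark that a rules-version needs a
relative Fait 1.4); in tree: route MellinCoarea (fibre-dimension filtration, top piece ≡ S, no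
residual) and EqualShadows (5082 ∧ RelEquiSlice ∧ SweepDescent, RelEquiSlice not implied by S).
Delta: the first EXACT two-piece split of Conjecture 1 whose stru  [refs: 2505.20397, paper:url-54a2e7be174a, paper:arxiv-2208.05182, Ayoub2015, HuberWustholz2022, BakkerTsimerman2025]

Barriers (technique_class: oracle-conservativity, functional-transcendence): - technique_class: oracle-conservativity, functional-transcendence, one-motives, o-minimal-cells
- Literature.Barriers.KontsevichZagierPeriods.noSemialgebraicPrimitive_inv_sub_two:
(AlgebraicPrimitivesObstruction, with algebraicPrimitivesObstructionNarrow) RelTransferOne lives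
exactly in its world (definite fibre integrals, primitives not semialgebraic) but evades the typed
obstruction because it concludes KZ.Equivalent through ALL dimensions (no relationsLE / EquivalentLE
truncation, cell trap T4) — excursions through higher-dimensional representations are allowed, as in
the ζ(2) nine-move certificate; KZModRelativeOne: inside (weight ≥ 2 NL steps), the bet is
EqualShadows' sweeps.
- Literature.Barriers.KontsevichZagierPeriods.cressonViuSos_prop_3_2: (HauptvermutungObstruction)
neither piece asks for a global comparison map between formalisms; both are statements inside the
one KZ calculus — outside.
- Literature.Barriers.KontsevichZagierPeriods.kzConjecture_implies_oddZetaAlgIndep: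
(GrothendieckPeriodConjectureDependence, with kzConjecture_implies_twoPiI_log_algIndep and
kzConjecture_implies_ellipticPeriods_algIndep) RelTransferOne sits in the 1-motivic layer (absolute:
HW theorem; relative: Ayoub / Bakker–Tsimerman theorems) where the dependence is discharged;
KZModRelativeOne carries it openly (declared residual) — it does not evade; the bet is that
quotienting by the whole relative layer is the largest theorem-fed bite available.
- Literature.Barriers.KontsevichZagierPer

sub-problem: KontsevichZagierPeriods · status: draft · opened planner-decomp-kz-writer-1-g0-0 2026-08-30T01:45:42Z · rev 1 · ledger route-KontsevichZagierPeriods-RootDecompRelativeOneConservativity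
GENERATED by the gate from the ledger (D-0016/17). Provers cite these decls: `theorem foo : Summit.KontsevichZagierPeriods.KontsevichZagierPeriods.Theses.RootDecompRelativeOneConservativity.<Decl> := …` in Summits/KontsevichZagierPeriods/KontsevichZagierPeriods/Theorems/<Name>.lean.
-/

namespace Summit.KontsevichZagierPeriods.KontsevichZagierPeriods.Theses.RootDecompRelativeOneConservativity

open scoped BigOperators Topology Manifold Classical MeasureTheory ProbabilityTheory Matrix InnerProductSpace ComplexConjugate ContinuousMap
open Filter Set Function TopologicalSpace MeasureTheory

attribute [summit_statement] _root_.KontsevichZagierPeriods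

open Literature Periods

/-- item stmt-KontsevichZagierPeriods-5082 · crux · rank 2 · open · by planner
why it might fail: for b ≥ 1 the correspondence explaining ρ ≡ ρ′ may exist only after a ramified base change (u ↦ u^{1/3}) or need base-dependent second-kind corrections with non-semialgebraic primitives, so no move template uniform on a cell exists.
sources: HuberWustholz2022, Ayoub2015, BakkerTsimerman2025, AyoubRelKZRevisited, KontsevichZagier2001, arXiv:2101.10938
[crux] the k = 1 stratum (card item N4 made general): two representations of dimension b + 1 whose
fibre integrals over the LAST coordinate agree for almost every base point x ∈ ℝ^b are
KZ-equivalent. b = 0 is Conjecture 1 for all 1-dimensional algebraic representations (incomplete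
abelian integrals of every genus: Huber–Wüstholz territory, LowDimension 0117); b ≥ 1 is its version
in families over a semialgebraic base, where the fibrewise identity ρ ≡ ρ′ between abelian-integral
families is a functional identity and the expected witness is a correspondence over ℚ(base) acting
by sheetwise changes of variables uniformly in the base (MultivaluedCoV.SheetTransfer in families)
plus Newton–Leibniz for exact corrections. A fibre-constant semialgebraic weight w(x) rides along
for free (apply the statement to w·r, w·r′), which is how u^{s−1} is carried. [difficulty:
open-problem] -/
@[route_item "route-KontsevichZagierPeriods-RootDecompRelativeOneConservativity", crux]
def RelTransferOne : Prop :=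
  ∀ ⦃b : ℕ⦄ (r r' : Literature.NumberTheory.Transcendental.KZ.IntegralRep (b + 1)), (∀ᵐ x : (Fin b → ℝ), (∫ t in {t : ℝ | (Fin.snoc x t : Fin (b + 1) → ℝ) ∈ r.domain}, r.integrand (Fin.snoc x t)) = ∫ t in {t : ℝ | (Fin.snoc x t : Fin (b + 1) → ℝ) ∈ r'.domain}, r'.integrand (Fin.snoc x t)) → Literature.NumberTheory.Transcendental.KZ.Equivalent r r'

/-- item stmt-KontsevichZagierPeriods-24332 · crux · rank 3 · SPLIT (gen 1) into RelTransferTwoModOne, KZModRelativeTwo + glue KZModRelativeOneGlue · direct attempts still welcome (low priority) · by planner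
why it might fail: as a target it still contains every weight ≥ 2 identity (ζ(2) = π²/6, Legendre's relation, Γ-products) modulo 1-motivic oracle steps — Grothendieck-strength content; only live mechanism: EqualShadows' RelEquiSlice ∧ SweepDescent.
sources: KontsevichZagier2001, Ayoub2015, CressonViusos2022, HuberMullerStach2017
[crux] [ROOT-DECOMP decomp-kz gen 0 · node C piece P2 · tag DECLARED-RESIDUAL(RelTransferOne) — S ⟹
P2 by `kzModRelativeOne_of_summit`; P2 ⟹ (RelTransferOne → S) (`critic_p2_conditional`), ≡ S the day
item 5082 lands; a LABEL, never WEAKER-by-evidence; tribunal role = residual (tribunal_fit); critic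
translation `critic_modRel_iff_enlarged` : P2 ↔ Conjecture 1 (rational endpoints, untruncated) for
the enlarged calculus closure(relations ∪ O₁) · NECESSARY (binder hB) · SHRINK certified as ≤ the
recorded residual: ReductionToDimensionOne (stmt-14403, AbelContraction) ⟹ P2
(`kzModRelativeOne_of_reductionToDimensionOne`, critic `critic_residual_le_R1`); strictness
UNDECIDED (test: does closure(relations ∪ {equal-valued dim-1 pairs}) already contain one genuinely
parametric O₁ instance, e.g. DuplicationFamily 3727) · leaf IDEA-NEEDED; the edge «RelEquiSlice ∧
SweepDescent ⟹ KZModRelativeOne» is CLAIMED by the lens, NOT kernel-checked (conjectural edge,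
critic w4) · cell score gen 1 = shrink it · census of record HOME/census/COSTUME-CENSUS-v1.md sha256
d820a1ccef7038cf1cf2195521173f232f3fb9dc74eaa204c7dee97b259d5198 (json
b41930f92fedc36ffa76fd1e9f0034d3b117c647635515f1ba8fb90c700a24cf) · -/
@[route_item "route-KontsevichZagierPeriods-RootDecompRelativeOneConservativity", crux]
def KZModRelativeOne : Prop :=
  ∀ R : AddSubgroup Literature.NumberTheory.Transcendental.KZ.FormalRep, Literature.NumberTheory.Transcendental.KZ.relations ≤ R → (∀ ⦃b : ℕ⦄ (r r' : Literature.NumberTheory.Transcendental.KZ.IntegralRep (b + 1)), (∀ᵐ x : (Fin b → ℝ), (∫ t in {t : ℝ | (Fin.snoc x t : Fin (b + 1) → ℝ) ∈ r.domain}, r.integrand (Fin.snoc x t)) = ∫ t in {t : ℝ | (Fin.snoc x t : Fin (b + 1) → ℝ) ∈ r'.domain}, r'.integrand (Fin.snoc x t)) → Literature.NumberTheory.Transcendental.KZ.of r - Literature.NumberTheory.Transcendental.KZ.of r' ∈ R) → ∀ ⦃n m : ℕ⦄ (r : Literature.NumberTheory.Transcendental.KZ.IntegralRep n) (r' : Literature.NumberTheory.Transcendental.KZ.IntegralRep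 m), r.IsRational → r'.IsRational → r.value = r'.value → Literature.NumberTheory.Transcendental.KZ.of r - Literature.NumberTheory.Transcendental.KZ.of r' ∈ R

-- parent: KZModRelativeOne · child (gen 1)
/--     item stmt-KontsevichZagierPeriods-25900 · crux · rank 301 · open
    parent: KZModRelativeOne · by planner
    why it might fail: its b = 0 layer contains, modulo 1-dim oracle steps, every weight-2 identity of 2-dim representations (ζ(2) = π²/6-type, five-term dilogarithm relations, Humbert volumes): a uniform move template may need excursions of unbounded dimension or inputs no O₁-step supplies.
    sources: KontsevichZagier2001, arXiv:2208.05182, arXiv:2101.10938, arXiv:2101.10968, Ayoub2015, Zagier1986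
[ROOT-DECOMP decomp-kz gen 2 · node C child P2 of the glued split of KZModRelativeOne 24332 (lens-3
«RelativeTowerTwo», HOME/decomp-kz-lens-3/RelativeTowerTwo.lean sha256
d6fe4bb442ec38aa6993004c86a658cb961c4fa6cfda23752a856b442dba2835: refines_iff 24332 ⟺ P2 ∧ P3,
kernel; glue P2 → P3 → 24332 = refines_iff.mpr, pure logic) · tag WEAKER — S ⟹ P2 (kernel); P2 ⟹ S
NOT known (fixed fibre dimension 2, no dimension-lowering move; critic concurs the O₂ oracle is not
known to absorb); ⟸ RelTransferTwo, ⟸ 24332 · its b = 0 layer carries KZDimTwo 4280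
(critic_prefix_carries_dimTwo) = the weight-2 wall of lens-1/6 · leaf IDEA-NEEDED(b = 0) +
INSTRUMENTABLE · census of record COSTUME-CENSUS-v2.md sha256
f4582ebbd0eecb48bde0fc748f10348233e83bb337e1ddbe9afe10142a7be0ba · verdict: critic decomp-kz-crit-1
CLEARED 2026-08-30T02:33:29Z (HOME/STATUS.md; CRITIC-LEDGER row «lens-3 gen-2 RelativeTowerTwo v1»;
probe HOME/critic/L3g2_RelativeTowerTwo_v1_probe.lean rc 0 std)] relative-dimension-two transfer
MODULO relative-dimension-one transfer (conservativity of O₂ over KZ + O₁): every subgroup R of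
formal combinations containing the four move sets and closed under O₁ contains [r] − [r′] whenever
r, r′ -/
@[route_item "route-KontsevichZagierPeriods-RootDecompRelativeOneConservativity"]
def RelTransferTwoModOne : Prop :=
  ∀ R : AddSubgroup Literature.NumberTheory.Transcendental.KZ.FormalRep, Literature.NumberTheory.Transcendental.KZ.relations ≤ R → (∀ ⦃b : ℕ⦄ (r r' : Literature.NumberTheory.Transcendental.KZ.IntegralRep (b + 1)), (∀ᵐ x : (Fin b → ℝ), (∫ t in {t : ℝ | (Fin.snoc x t : Fin (b + 1) → ℝ) ∈ r.domain}, r.integrand (Fin.snoc x t)) = ∫ t in {t : ℝ | (Fin.snoc x t : Fin (b + 1) → ℝ) ∈ r'.domain}, r'.integrand (Fin.snoc x t)) → Literature.NumberTheory.Transcendental.KZ.of r - Literature.NumberTheory.Transcendental.KZ.of r' ∈ R) → ∀ ⦃b : ℕ⦄ (r r' : Literature.NumberTheory.Transcendental.KZ.IntegralRep (b + 2)), (∀ᵐ x : (Fin b → ℝ), (∫ t : ℝ, ∫ u in {u : ℝ | (Fin.snoc (Fin.snoc x t : Fin (b + 1) → ℝ) u : Fin (b + 2) → ℝ) ∈ r.domain},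 r.integrand (Fin.snoc (Fin.snoc x t : Fin (b + 1) → ℝ) u)) = ∫ t : ℝ, ∫ u in {u : ℝ | (Fin.snoc (Fin.snoc x t : Fin (b + 1) → ℝ) u : Fin (b + 2) → ℝ) ∈ r'.domain}, r'.integrand (Fin.snoc (Fin.snoc x t : Fin (b + 1) → ℝ) u)) → Literature.NumberTheory.Transcendental.KZ.of r - Literature.NumberTheory.Transcendental.KZ.of r' ∈ R

-- parent: KZModRelativeOne · child (gen 1)
/--     item stmt-KontsevichZagierPeriods-25901 · crux · rank 302 · open
    parent: KZModRelativeOne · by planner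
    why it might fail: as a target it still contains every weight ≥ 3 identity (ζ(3)-, ζ(5)-representations, MZV double shuffle in depth ≥ 2, Γ-products) modulo 2-dim oracle steps — Grothendieck-strength content; no mechanism beyond iterating the tower is known.
    sources: KontsevichZagier2001, Ayoub2015, HuberMullerStach2017, Fresan2024
[ROOT-DECOMP decomp-kz gen 2 · node C child P3 of the glued split of KZModRelativeOne 24332 (lens-3
«RelativeTowerTwo», HOME/decomp-kz-lens-3/RelativeTowerTwo.lean sha256
d6fe4bb442ec38aa6993004c86a658cb961c4fa6cfda23752a856b442dba2835) · tag
DECLARED-RESIDUAL(RelTransferOne ∧ RelTransferTwoModOne) (critic_P3_residual_shape) — SHRINK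
CERTIFIED, best in cell: P3 ⟸ 24332, ⟸ 23649 (lens-1 KernelDescentTwo), ⟸ 18030, ⟸ 14403
(critic_residual_weakest; converses unknown) · leaf IDEA-NEEDED · score gen 3 = the b = 0 layer of
P2 (KZDimTwo mod O₁) or a uniform-in-b template, not O₃ · verdict: critic decomp-kz-crit-1 CLEARED
2026-08-30T02:33:29Z (HOME/STATUS.md; CRITIC-LEDGER row «lens-3 gen-2 RelativeTowerTwo v1»; probe
HOME/critic/L3g2_RelativeTowerTwo_v1_probe.lean rc 0 std)] Conjecture 1 modulo the
relative-dimension-two oracle (completeness of KZ + O₂), the DECLARED RESIDUAL: every subgroup R of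
formal combinations containing the four move sets and closed under O₂ (R ∋ [r] − [r′] whenever r, r′
: IntegralRep (b+2) have a.e.-equal iterated fibre integrals over the last two coordinates) contains
[r] − [r′] for every pair of KZ-rational representations with equal values. Implied by S; impl -/
@[route_item "route-KontsevichZagierPeriods-RootDecompRelativeOneConservativity"]
def KZModRelativeTwo : Prop :=
  ∀ R : AddSubgroup Literature.NumberTheory.Transcendental.KZ.FormalRep, Literature.NumberTheory.Transcendental.KZ.relations ≤ R → (∀ ⦃b : ℕ⦄ (r r' : Literature.NumberTheory.Transcendental.KZ.IntegralRep (b + 2)), (∀ᵐ x : (Fin b → ℝ), (∫ t : ℝ, ∫ u in {u : ℝ | (Fin.snoc (Fin.snoc x t : Fin (b + 1) → ℝ) u : Fin (b + 2) → ℝ) ∈ r.domain}, r.integrand (Fin.snoc (Fin.snoc x t : Fin (b + 1) → ℝ) u)) = ∫ t : ℝ, ∫ u in {u : ℝ | (Fin.snoc (Fin.snoc x t : Fin (b + 1) → ℝ) u : Fin (b + 2) → ℝ) ∈ r'.domain}, r'.integrand (Fin.snoc (Fin.snoc x t : Fin (b + 1) → ℝ) u)) → Literature.NumberTheory.Transcendental.KZ.of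 r - Literature.NumberTheory.Transcendental.KZ.of r' ∈ R) → ∀ ⦃n m : ℕ⦄ (r : Literature.NumberTheory.Transcendental.KZ.IntegralRep n) (r' : Literature.NumberTheory.Transcendental.KZ.IntegralRep m), r.IsRational → r'.IsRational → r.value = r'.value → Literature.NumberTheory.Transcendental.KZ.of r - Literature.NumberTheory.Transcendental.KZ.of r' ∈ R

-- parent: KZModRelativeOne · glue (gen 1)
/--     item stmt-KontsevichZagierPeriods-25902 · support · rank 303 · open
    parent: KZModRelativeOne · GLUE: children ⟹ parent · by planner
gen-2 tower refinement (lens-3 RelativeTowerTwo, critic CLEARED 02:33:29Z, option A):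
KZModRelativeOne 24332 ⟸ RelTransferTwoModOne → KZModRelativeTwo → KZModRelativeOne; proof = pure
logic (refines_iff.mpr in HOME/decomp-kz-lens-3/RelativeTowerTwo.lean sha256 d6fe4bb4…2835: fun hB
hC R hR hO₁ n m r rp hr hrp hv => hC R hR (hB R hR hO₁) r rp hr hrp hv) -/
@[route_item "route-KontsevichZagierPeriods-RootDecompRelativeOneConservativity"]
def KZModRelativeOneGlue : Prop :=
  RelTransferTwoModOne → KZModRelativeTwo → KZModRelativeOne

/-- item stmt-KontsevichZagierPeriods-24333 · assembly · rank 1 · open · by planner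
sources: KontsevichZagier2001
[assembly] RelTransferOne → KZModRelativeOne → the summit statement (the schema's mandatory assembly
item; the deciding theorem is `closes`, proved in glue.lean; advisory `glue.unused-crux [Assembly]`
on the native check is the expected reading of an assembly def). -/
@[route_item "route-KontsevichZagierPeriods-RootDecompRelativeOneConservativity"]
def Assembly : Prop :=
  RelTransferOne → KZModRelativeOne → KontsevichZagierPeriods

/-! D-0027 §2.1 — DECIDING THEOREM (planner-authored via `route open/edit --closes-file`; by planner-decomp-kz-writer-1-g0-0 2026-08-30T01:45:42Z):
its hypotheses are this route's items and its conclusion the sub-problem Statement (glue_lint), and it elaborates with this file. -/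

@[closes "route-KontsevichZagierPeriods-RootDecompRelativeOneConservativity"] theorem closes (hA : RelTransferOne) (hB : KZModRelativeOne) : _root_.KontsevichZagierPeriods := by
  rw [KontsevichZagierPeriods_iff]
  intro n m r r' hr hr' hv
  exact hB Literature.NumberTheory.Transcendental.KZ.relations le_rfl (fun b s s' hs => hA s s' hs) r r' hr hr' hv

end Summit.KontsevichZagierPeriods.KontsevichZagierPeriods.Theses.RootDecompRelativeOneConservativity
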